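import Mathlib
import HarnessLib
import HarnessLib.Audit
import Summits.AtomisticToContinuum.Statement
import Literature.MathematicalPhysics.StatisticalMechanics.BarlowStacking
import Summits.AtomisticToContinuum.Crystallization.Theorems.PalmUnimodularRigidityChargedPatternCrystallizes
import Summits.AtomisticToContinuum.Crystallization.Theorems.PricedLinkCensusChargedPeriodicIsOptimal

/-!
Route: SumsetDoublingRigidity

DORMANT since 2026-09-04T19:05:58Z (reconciler: no traction for 5 d (last activity statement-checked at 2026-08-30T17:58:30Z); parked, not closed — `ledger route dormant route-AtomisticToContinuum-SumsetDoublingRigidity --off` to reacti) — unstaffed, not closed; items shared with open routes are served there. `ledger route dormant <id> --off` reactivates.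

# Route SumsetDoublingRigidity — fewer than two pair-sums per atom — sumset doubling of a charged
limit plus a Kneser rung make Lennard-Jones ground states periodic, identification-free

It suffices to show X = X₁ ∧ X₂ (realising card hcp-least-nonlattice-doubling-gap, critic-graded
new-mechanism, unrouted).
Measure the DOUBLING of a locally finite set X ⊂ ℝ³ in density form on balls about the origin,
κ_R(X) = #((X+X) ∩ B_R)/#(X ∩ B_R)
(Bravais lattice 1, hcp and every 2-lattice 3/2, AP-polytypes 9R 5/3, 12R 7/4, dhcp 2, model sets ≥
2, one generic displaced atom +1).
X₁ = SmallDoublingCharged: every sequence of Lennard-Jones ground states in ℝ³ charges, with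
positive density at every scale (the exact
format of the shared hinge 2911, rotations and base points free), the windows of ONE set X that is
δ-separated, (9/10)δ-covered
(saturated) and has κ_R(X) ≤ θ < 2 for all large R. X₂ = DoublingRungRigidity: every δ-separated,
(9/10)δ-covered X ⊂ ℝ³ with
κ_R(X) ≤ θ < 2 eventually is the point set of a PeriodicConfiguration 3 (Kneser's threshold; no
structure named). Then X is periodic and
charged, which is GroundStatesChargePeriodic (2911); the PROVED tree theorems
chargedPatternCrystallizes_proof (2916),
chargedPeriodicIsOptimal_proof (2913) and crysEnergyLimit (0626) give both conjuncts without ever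
identifying the crystal.
Lean: `SmallDoublingCharged ∧ DoublingRungRigidity`

## Assembly
Pure logic plus PROVED tree theorems (Sketch.lean / glue.lean, lean check rc 0, 0 sorries): given a
ground-state sequence x,
SmallDoublingCharged gives X with separation/covering, doubling < 2 and the charging clause;
DoublingRungRigidity gives P with
P.points = X (subst), i.e. the conclusion of GroundStatesChargePeriodic for x;
chargedPatternCrystallizes_proof (item 2916) with
LennardJonesMinimalDistance_holds gives IsCrystallizing lennardJones 3; a ground-state sequence
exists
(LennardJonesGroundStatesExist_holds), its charged P is least by chargedPeriodicIsOptimal_proof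
(item 2913), and
ChargedEnergyGapNegative.crysEnergyLimit (item 0626) rewritten by IsLeast.csInf_eq is the Tendsto
clause: HasPeriodicGroundStateEnergy ∧
IsCrystallizing = Crystallization. The supports are not used by `closes` (HingeFromDoubling is its
first step, inlined; the hinge 2911 is derived, not assumed). Import cone (route-repair 2026-08-16,
unit rrepair-AtomisticToContinuum-SumsetDou-f61950b9): gate deps 0 unproved of 29 project constants
(staffable); the module-cone count 6 is the summit's own OPEN conjunct statements
Literature.MathematicalPhysics.KineticTheory.HydrodynamicLimit, .HydrodynamicLimitDim,
.HydroLimitInBandDim (the last two since the D-0032 re-type of 2026-08-16),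
Literature.MathematicalPhysics.KineticTheory.HeatConduction.FouriersLaw,
Literature.MathematicalPhysics.StatisticalMechanics.Crystallization (the conclusion of `closes`) and
Literature.MathematicalPhysics.QuantumManyBody.BoseGas.BoseEinsteinCondensation, all riding in on
the gate auto-import Summits.AtomisticToContinuum.Statement (and Crystallization/Statement.lean),
hence in the cone of every route of this summit and not planner-controllable; none is a hypothesis
of `closes` or referenced by any item (28 Literature files in the cone, 77 binder-less cited Prop
facts, 71 discharged). needs-fact: NONE; 0 imports dropped (BarlowStacking gives hcpStacking; the
two Theorems modules give the three proved theorems `closes` applies and carry only discharged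
facts), 0 cruxes restated.

Rationale: WHY THIS LINE. Mechanism (card hcp-least-nonlattice-doubling-gap): replace the geometric periodicity
endgame (kissing-12 ⇒ Barlow shells ⇒ layers ⇒
Hägg word ⇒ selection, HalesDSP2012 §1.3) by an ADDITIVE one — a single affine-invariant scalar, the
density of the sumset X+X relative
to X, followed by an inverse sumset theorem: below Kneser's threshold 2 (Kneser1953; TaoVu2006 §5) a
saturated hard-core set must be a
finite union of lattice cosets in arithmetic progression, hence periodic; hcp, the expected
Lennard-Jones crystal, is the least
non-lattice value 3/2 (finite-abelian Freiman 3/2, Mathlib `doubling_lt_three_halves`). Imported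
area: additive combinatorics /
aperiodic order — the qualitative rung "finite doubling ⇒ Meyer ⇒ cut-and-project + finite" is
Lagarias1996 / Konieczny2023
(arXiv:2103.02289, via Freiman–Ruzsa, internal dimension O(d log K)) / Machado2025
(arXiv:2304.12509); the threshold-2 periodicity
with saturation is the new theorem X₂. Planner deltas w.r.t. the card: density form (robust to the
finite-window undercount), threshold
2 instead of 5/3, conclusion weakened from "lattice or 2-lattice" to "periodic" and the finite
minimisation K3 DROPPED — the in-tree
surgery/charging theorems (2913, 2916, both proved 2026-08-16) make identification of hcp
unnecessary. What it does that the 39 open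
routes do not: the four periodicity engines in play are Hales's exact local theorem
(HullExactificationCascade), Bieberbach on Palm atoms
(IsometryAtoms), analytic unique continuation + Boyle–Lind (HolmgrenBoyleLind) and Lev–Olevskii
(BraggSlacknessRigidity); none is
additive, all need shells, orbits, FLC or Bragg support; here the input is one 4-point statistic,
blind to c/a, strain, tolerance and
stacking alphabet, and the Lean base is strong exactly there (tree PolynomialFreimanRuzsa_holds,
LinearKneser_holds; Mathlib
VerySmallDoubling, PlünneckeRuzsa).

RANKED CRUXES. #2 SmallDoublingCharged (crux) — (card K1 in charging form, threshold relaxed to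
Kneser's 2) for every sequence of Lennard-Jones ground states x^N in ℝ³ there is ONE set X ⊂ ℝ³,
δ-separated and (9/10)δ-covered for some δ > 0, whose sumset is locally finite with #((X+X) ∩ B_R) ≤
θ·#(X ∩ B_R) for some θ < 2 and all large R, such that for all R, ε > 0 there is ρ > 0 with,
frequently in N, at least ρN particles whose R-neighbourhood is two-way ε-matched with x_i + A(X −
q) for some linear isometry A and base point q ∈ X. Expected X: relaxed hcp (κ = 3/2,
covering/separation 1/√2). [difficulty: open-problem] (why it might fail: No energetic engine yet
forces few pair-sums (energy sees radial shells, κ sees vector coincidences; critic: as hard as the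
endgame it replaces); needs an EXACT defect-free charged set (one generic displaced atom adds 1 to
κ); false if LJ charges only κ ≥ 2 structures (dhcp, generic motifs).) [BlancLewin2015,
FlatleyTheil2015, HalesDSP2012, Konieczny2023]
#3 DoublingRungRigidity (crux) — (card K2, conclusion weakened to "periodic") every X ⊂ ℝ³ that is
δ-separated and (9/10)δ-covered for some δ > 0 and whose sumset satisfies #((X+X) ∩ B_R) ≤ θ·#(X ∩
B_R) for some θ < 2 and all large R (with (X+X) ∩ B_R finite) is the point set of a
PeriodicConfiguration 3. Intended proof: Ruzsa triangle ⇒ D⁺(X−X) < ∞ ⇒ X ⊂ M + F Meyer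
(Lagarias1996, Konieczny2023 Thm 1.1/1.3) ⇒ internal dimension 0 from κ < 2 (Brunn–Minkowski/Kneser
in the internal group; model sets have κ = vol(W+W)/vol(W) ≥ 2^e) ⇒ X inside a crystal L + F ⇒
saturation + separation exclude vacancy/addition/selection offenders ⇒ X periodic. [difficulty: L]
(why it might fail: An aperiodic saturated separated set with κ < 2 may exist: dense aperiodic
sub-crystals passing the 9/10 covering test, or Meyer sets with thin/fractal windows where internal
Brunn–Minkowski does not control a countable sumset; 9/10 is a choice in (1/√2, 1).) [Kneser1953,
Konieczny2023, Machado2025, Lagarias1996, BjorklundHartnick2018, TaoVu2006]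
#9 GroundStatesChargePeriodic (support) — (shared hinge stmt-2911, verbatim; filed as a support so
the ledger records that this route wants it — X₁ ∧ X₂ imply it by HingeFromDoubling) every sequence
of LJ ground states in ℝ³ charges ONE periodic configuration Q with positive density at every scale
(rotations and base points q ∈ Q.points free). X₁ ∧ X₂ give it in two lines (X periodic by X₂,
subst). [deps: HingeFromDoubling] (why it might fail: Of crystallization strength (wanted by 10
routes): fails iff no periodic structure is charged with positive density — positive density of
defects/polytetrahedral order at every N, or only aperiodic (Sturmian-stacked) bulk.)
[BlancLewin2015, HalesDSP2012]
#9 HingeFromDoubling (support) — (glue to the target, provable now — it is the first five lines of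
`closes`) SmallDoublingCharged and DoublingRungRigidity imply GroundStatesChargePeriodic: take the
charged X, get P with P.points = X, substitute. [deps: SmallDoublingCharged, DoublingRungRigidity]
[difficulty: provable-now] [BlancLewin2015]
#9 FirstGapBravais (support) — (card P1/K2(a), the first gap, provable) a periodic configuration
whose point set is δ-separated, (9/10)δ-covered and has #((P+P) ∩ B_R) ≤ θ·#(P ∩ B_R) for some θ <
3/2 and all large R is a Bravais lattice (one-point motif): finite-abelian Freiman 3/2 in ℝ³/L
(Mathlib `doubling_lt_three_halves`) puts the motif in a coset of a finite subgroup of index <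
3/2·#motif; density > 2/3 forbids short vectors; covering ≤ (9/10)δ forbids missing points.
[difficulty: L] [Kneser1953, TaoVu2006, Konieczny2023]
#9 HcpDoublingThreeHalves (support) — (consistency of the rank-2 crux with the expected charged
structure; provable) for the hcp point set hcpStacking a h (a, h > 0) and every θ > 3/2, for all
large R the sumset count satisfies #((X+X) ∩ B_R) ≤ θ·#(X ∩ B_R) (X + X = L ∪ (L+t) ∪ (L+2t) for X =
L ∪ (L+t): density ratio exactly 3/2; lattice-point counting in balls). [difficulty: M]
[BlancLewin2015, BaakeGrimm2013]

TWO-LAYER PLAN. Foreseen glued splits (none filed now). DoublingRungRigidity ⇐ MeyerFromDoubling (κ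
< 2 + Delone ⇒ X − X uniformly discrete: Ruzsa
triangle on windows + Konieczny2023 Thm 3.1 / Lagarias1996) → SaturatedSubcrystalPeriodic (a
δ-separated (9/10)δ-covered subset of
M + F with κ < 2 has internal dimension 0 and equals a union of lattice cosets) →
DoublingRungRigidity. SmallDoublingCharged ⇐
ExactSaturatedChargedSet (exactification: some δ-separated (9/10)δ-covered X is charged with
positive density at every scale — the
HullGoodEverywhere/HullExactShells pattern, proved for 12-shell goodness) → ChargedSetsFewSums
(every such charged X has κ < 2) →
SmallDoublingCharged.

KILL CRITERIA. An explicit aperiodic, δ-separated, (9/10)δ-covered X ⊂ ℝ³ with κ < 2 refutes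
DoublingRungRigidity: restate at the card's second rung
(θ < 5/3, conclusion "lattice or 2-lattice or AP-cosets") or add finite local complexity; refuted
below 5/3 as well ⇒ close
refuted:DoublingRungRigidity. SmallDoublingCharged refuted (a proof that every saturated set charged
by LJ ground states has κ ≥ 2 —
e.g. certified stacking numerics selecting dhcp/long-period polytypes, or positive density of exact
defects) ⇒ close
refuted:SmallDoublingCharged (the additive endgame survives only as the Literature theorem X₂).
GroundStatesChargePeriodic (2911) proved
by any other route moots this one (Crystallization follows there).

NOT DECOMPOSED YET. The exactification step inside SmallDoublingCharged (shared pattern with the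
hull routes, typed only when a prover asks); the
quantitative internal-dimension bound and the Meyer step inside DoublingRungRigidity (layer-2
children above); robust 99 % / BSG versions
of the rung (card K2(c), open and false without saturation); any identification of the charged
structure as hcp (never needed:
ChargedPeriodicIsOptimal makes the charged P least whatever it is); the constant 9/10 (any c ∈
(1/√2, 1) would do).

CHEAPEST FALSIFIER. Construct an aperiodic saturated separated set with κ < 2 (kills X₂ at once).
Run by hand this session on the five cheap families:
vacancy subsets of a crystal (κ down to 1/σ < 2 but covering radius ≥ δ: excluded), sparse additions
(R_c(X) ≤ 0.9·dist(junk, X) ≤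
0.9·R_c(X): excluded), m generic displaced atoms (κ ≥ 1 + m ≥ 2: excluded by the strict threshold),
interval-window model sets such as
A₂ × Sturmian heights (saturated, κ = 2 exactly, not < 2), close-pair selections (L∖S) ∪ (S+u) (κ ≥
2 + dens S): none passes — the
threshold 2 is sharp from both sides (AP-cosets (2k−1)/k ↑ 2 periodic; model sets ↓ 2 aperiodic).
Next cheapest: the card's
enumeration of saturated hard-core motifs |F| ≤ 8 in frames (ℤ/n)³, n ≤ 6 (calibration only:
periodic sets cannot refute X₂), and for
X₁ the certified stacking numerics (hcp beats fcc by 7e-5·|e*|; dhcp would give κ = 2 and kill X₁).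

NUMBERS. κ = dens(X+X)/dens(X) (card P1 table, re-derived): fcc, bcc, sc 1 · hcp, diamond, every
2-lattice 3/2 · 9R 5/3 · 12R 7/4 · dhcp,
4H 2 · 6H 7/3 · generic Barlow word → 3 · C15 17/6 · A15 29/8 · model set with window W ⊂ ℝ^e:
vol(W+W)/vol(W) ≥ 2^e · Mackay
icosahedra unbounded. Covering/separation: fcc, hcp 1/√2 = 0.707; bcc 0.645; any single vacancy or
interstitial ≥ 1 (threshold 9/10).
Zero-pressure LJ energies per particle, V = r⁻¹²/12 − r⁻⁶/6 (this session, compute/a15_lj.py, R = 7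
+ r⁻³ tail): fcc −0.717519,
hcp −0.717591 (Δ = 7.2e-5), bcc −0.686448 (+4.3 %), A15 −0.631362 (+12 %), C15-mono −0.588178 (+18
%); nearest-neighbour distance at
optimum 0.9712. Items at open: 7 (2 cruxes, 4 supports incl. the shared hinge 2911, assembly).

DEFINITION REQUESTS. None needed at open (separation, covering, sumset counts and charging are
inlined over Mathlib Set.ncard / Nat.card and
Literature PeriodicConfiguration / hcpStacking). If X₂ is vendored as Literature later: notions
`doublingRatio` and
`IsSaturatedDelone` under Literature/Geometry/AperiodicOrder (not filed now).

Novelty: Searches (2026-08-16): lit search --source arxiv|zbmath "approximate lattices Meyer sets doubling"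
(1: arXiv:2304.12509 Machado2025,
read Thms 1.1–1.3, Prop 4.2), "Kneser theorem upper Banach density abelian groups" (2:
arXiv:1911.07745 Bienvenu–Hennecart,
arXiv:2602.19014 Griesmer), "Freiman theorem Delone sets" (0 relevant), "sets with small sumset
Euclidean space structure" (0),
"sumset crystal lattice sphere packing additive energy" (0); lit read arXiv:2103.02289
(Konieczny2023 Thm 1.1, 1.3, 3.1 — the
finite-window doubling of A ∩ B(0,N) is exactly our formulation); lit galaxy search --star all
"Meyer set small doubling" (0),
"Freiman" (noise), "crystallization conjecture" (10, none additive); local FTS index unavailable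
(searchd connection reset, OpenAlex 429)
— logged in NOTES; lean search: Mathlib VerySmallDoubling (doubling_lt_three_halves), tree
PolynomialFreimanRuzsa_holds,
LinearKneser_holds, no Delone/Meyer doubling decls; grep of the 78 Crystallization theses for
Freiman|sumset|doubling: 0.
Nearest prior art found: Konieczny2023 (doi:10.1016/j.jnt.2023.06.012) and Lagarias1996 /
Machado2025 (doi:10.1017/etds.2025.10253):
finite doubling of a relatively dense set ⇔ Meyer ⇔ inside cut-and-project + finite, internal
dimension O(d log K) — qualitative, no
threshold-2 periodicity, no saturation, no energy; on this problem the card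
hcp-least-nonlattice-doubling-gap (mechhunt 2271-7, critic
new-mechanism 2026-08-16), which this route realises; nearest routes IsometryAto  [refs: 10.1016/j.jnt.2023.06.012, 10.1017/etds.2025.10253, 2304.12509, 1911.07745, 2602.19014, 2103.02289, doi:10.1016/j.jnt.2023.06.012, doi:10.1017/etds.2025.10253, Machado2025, Konieczny2023, Lagarias1996]

Barriers (technique_class: additive-combinatorics sumset-doubling freiman-kneser): - technique_class: additive-combinatorics sumset-doubling freiman-kneser
- Literature.Barriers.AtomisticToContinuum.NoUniversallyOptimalLattice3D: evaded — no
potential-independent or two-point certificate is sought; κ separates "how far from a lattice"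
(rigid, X₂) from "which lattice" (never asked: ChargedPeriodicIsOptimal makes the charged P least
whatever it is).
- Literature.Barriers.AtomisticToContinuum.HcpNotBravais: absorbed — hcp is the second rung κ = 3/2
< 2; the conclusion of X₂ is "periodic", not "lattice".
- Literature.Barriers.AtomisticToContinuum.Li2022_cohnElkies3D: evaded — no LP/Fourier bound; the
only inequality is combinatorial (Kneser/Brunn–Minkowski in the internal group of a Meyer set).
- Literature.Barriers.AtomisticToContinuum.KissingTwelveDegeneracy: the endgame counts no neighbours
and classifies no shells; NOT evaded inside X₁ — whatever proves κ < 2 from minimality must exclude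
polytetrahedral order; the bet is that an affine-invariant 4-point statistic is a different handle
than 12-coordination with η-margins (honest: no engine yet).
- Literature.Barriers.AtomisticToContinuum.FlexibleKissingArrangements: same — no one-shell rigidity
is used; the flexible icosahedral shell is invisible to X₂ and must be priced inside X₁.
- Literature.Barriers.AtomisticToContinuum.ShortRangeStackingBlindness: not evaded — X₁ carries
stacking selection down to "κ < 2" (fcc 1, hcp 3/2, 9R 5/3, 12R 7/4 pass; dhcp 2 and aperiodic words
fail); an LJ-charged Sturmian or

History (route lifecycle, newest last):
- 2026-08-23T03:03:36Z · DORMANT — reconciler: no traction for 5.9 d (last activity statement-grounded at 2026-08-17T05:42:06Z); parked, not closed — `ledger route dormant route-AtomisticToContin (operator:999:1331086)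
- 2026-08-30T17:52:46Z · REACTIVATED (open) — reconciler: reactivated — activity statement-checked at 2026-08-30T16:52:29Z after parking at 2026-08-23T03:03:36Z (operator:999:1985565)
- 2026-09-04T19:05:58Z · DORMANT — reconciler: no traction for 5 d (last activity statement-checked at 2026-08-30T17:58:30Z); parked, not closed — `ledger route dormant route-AtomisticToContinuum (operator:999:2440800)

sub-problem: Crystallization · status: dormant · opened planner-plan-novel-AtomisticToContinuum-Crystal-ad211d65-v2-g6-0 2026-08-16T21:41:28Z · rev 2 · ledger route-AtomisticToContinuum-SumsetDoublingRigidity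
GENERATED by the gate from the ledger (D-0016/17). Provers cite these decls: `theorem foo : Summit.AtomisticToContinuum.Crystallization.Theses.SumsetDoublingRigidity.<Decl> := …` in Summits/AtomisticToContinuum/Crystallization/Theorems/<Name>.lean.
-/

namespace Summit.AtomisticToContinuum.Crystallization.Theses.SumsetDoublingRigidity

open scoped BigOperators Topology Manifold Classical MeasureTheory ProbabilityTheory Matrix InnerProductSpace ComplexConjugate ContinuousMap
open Filter Set Function TopologicalSpace MeasureTheory

attribute [summit_statement] _root_.Crystallization

/-- item stmt-AtomisticToContinuum-16933 · crux · rank 2 · open · by planner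
why it might fail: No energetic engine yet forces few pair-sums (energy sees radial shells, κ sees vector coincidences; critic: as hard as the endgame it replaces); needs an EXACT defect-free charged set (one generic displaced atom adds 1 to κ); false if LJ charges only κ ≥ 2 structures (dhcp, generic motifs).
sources: BlancLewin2015, FlatleyTheil2015, HalesDSP2012, Konieczny2023
[crux] (card K1 in charging form, threshold relaxed to Kneser's 2) for every sequence of
Lennard-Jones ground states x^N in ℝ³ there is ONE set X ⊂ ℝ³, δ-separated and (9/10)δ-covered for
some δ > 0, whose sumset is locally finite with #((X+X) ∩ B_R) ≤ θ·#(X ∩ B_R) for some θ < 2 and all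
large R, such that for all R, ε > 0 there is ρ > 0 with, frequently in N, at least ρN particles
whose R-neighbourhood is two-way ε-matched with x_i + A(X − q) for some linear isometry A and base
point q ∈ X. Expected X: relaxed hcp (κ = 3/2, covering/separation 1/√2). [difficulty: open-problem] -/
@[route_item "route-AtomisticToContinuum-SumsetDoublingRigidity"]
def SmallDoublingCharged : Prop :=
  ∀ x : (N : ℕ) → (Fin N → EuclideanSpace ℝ (Fin 3)), (∀ N, Literature.MathematicalPhysics.StatisticalMechanics.IsGroundState Literature.MathematicalPhysics.StatisticalMechanics.lennardJones (x N)) → ∃ X : Set (EuclideanSpace ℝ (Fin 3)), (∃ δ : ℝ, 0 < δ ∧ (∀ a ∈ X, ∀ b ∈ X, a ≠ b → δ ≤ dist a b) ∧ (∀ z : EuclideanSpace ℝ (Fin 3), ∃ a ∈ X, dist z a ≤ 9 / 10 * δ)) ∧ (∃ θ : ℝ, θ < 2 ∧ ∃ R₀ : ℝ, ∀ R : ℝ, R₀ ≤ R → ({v : EuclideanSpace ℝ (Fin 3) | ‖v‖ ≤ R ∧ ∃ a ∈ X, ∃ b ∈ X, v = a + b} : Set (EuclideanSpace ℝ (Fin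 3))).Finite ∧ (({v : EuclideanSpace ℝ (Fin 3) | ‖v‖ ≤ R ∧ ∃ a ∈ X, ∃ b ∈ X, v = a + b} : Set (EuclideanSpace ℝ (Fin 3))).ncard : ℝ) ≤ θ * (({a : EuclideanSpace ℝ (Fin 3) | a ∈ X ∧ ‖a‖ ≤ R} : Set (EuclideanSpace ℝ (Fin 3))).ncard : ℝ)) ∧ ∀ R ε : ℝ, 0 < R → 0 < ε → ∃ ρ : ℝ, 0 < ρ ∧ ∃ᶠ N : ℕ in Filter.atTop, ρ * (N : ℝ) ≤ (Nat.card {i : Fin N // ∃ A : EuclideanSpace ℝ (Fin 3) →ₗᵢ[ℝ] EuclideanSpace ℝ (Fin 3), ∃ q ∈ X, (∀ s ∈ X, dist s q ≤ R → ∃ j : Fin N, dist (x N j) (x N i + A (s - q)) ≤ ε) ∧ (∀ j : Fin N, dist (x N j) (x N i) ≤ R → ∃ s ∈ X, dist (x N j) (x N i + A (s - q)) ≤ ε)} : ℝ)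

/-- item stmt-AtomisticToContinuum-16934 · crux · rank 3 · open · by planner
why it might fail: An aperiodic saturated separated set with κ < 2 may exist: dense aperiodic sub-crystals passing the 9/10 covering test, or Meyer sets with thin/fractal windows where internal Brunn–Minkowski does not control a countable sumset; 9/10 is a choice in (1/√2, 1).
sources: Kneser1953, Konieczny2023, Machado2025, Lagarias1996, BjorklundHartnick2018, TaoVu2006
[crux] (card K2, conclusion weakened to "periodic") every X ⊂ ℝ³ that is δ-separated and
(9/10)δ-covered for some δ > 0 and whose sumset satisfies #((X+X) ∩ B_R) ≤ θ·#(X ∩ B_R) for some θ <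
2 and all large R (with (X+X) ∩ B_R finite) is the point set of a PeriodicConfiguration 3. Intended
proof: Ruzsa triangle ⇒ D⁺(X−X) < ∞ ⇒ X ⊂ M + F Meyer (Lagarias1996, Konieczny2023 Thm 1.1/1.3) ⇒
internal dimension 0 from κ < 2 (Brunn–Minkowski/Kneser in the internal group; model sets have κ =
vol(W+W)/vol(W) ≥ 2^e) ⇒ X inside a crystal L + F ⇒ saturation + separation exclude
vacancy/addition/selection offenders ⇒ X periodic. [difficulty: L] -/
@[route_item "route-AtomisticToContinuum-SumsetDoublingRigidity"]
def DoublingRungRigidity : Prop :=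
  ∀ X : Set (EuclideanSpace ℝ (Fin 3)), (∃ δ : ℝ, 0 < δ ∧ (∀ a ∈ X, ∀ b ∈ X, a ≠ b → δ ≤ dist a b) ∧ (∀ z : EuclideanSpace ℝ (Fin 3), ∃ a ∈ X, dist z a ≤ 9 / 10 * δ)) → (∃ θ : ℝ, θ < 2 ∧ ∃ R₀ : ℝ, ∀ R : ℝ, R₀ ≤ R → ({v : EuclideanSpace ℝ (Fin 3) | ‖v‖ ≤ R ∧ ∃ a ∈ X, ∃ b ∈ X, v = a + b} : Set (EuclideanSpace ℝ (Fin 3))).Finite ∧ (({v : EuclideanSpace ℝ (Fin 3) | ‖v‖ ≤ R ∧ ∃ a ∈ X, ∃ b ∈ X, v = a + b} : Set (EuclideanSpace ℝ (Fin 3))).ncard : ℝ) ≤ θ * (({a : EuclideanSpace ℝ (Fin 3) | a ∈ X ∧ ‖a‖ ≤ R} : Set (EuclideanSpace ℝ (Fin 3))).ncard : ℝ)) → ∃ P : Literature.MathematicalPhysics.StatisticalMechanics.PeriodicConfiguration 3, P.points = X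

/-- item stmt-AtomisticToContinuum-16935 · support · rank 9 · open · by planner
sources: BlancLewin2015
[support] (glue to the target, provable now — it is the first five lines of `closes`)
SmallDoublingCharged and DoublingRungRigidity imply GroundStatesChargePeriodic: take the charged X,
get P with P.points = X, substitute. [deps: SmallDoublingCharged, DoublingRungRigidity] [difficulty:
provable-now] -/
@[route_item "route-AtomisticToContinuum-SumsetDoublingRigidity"]
def HingeFromDoubling : Prop :=
  SmallDoublingCharged → DoublingRungRigidity → ∀ x : (N : ℕ) → (Fin N → EuclideanSpace ℝ (Fin 3)), (∀ N, Literature.MathematicalPhysics.StatisticalMechanics.IsGroundState Literature.MathematicalPhysics.StatisticalMechanics.lennardJones (x N)) → ∃ Q : Literature.MathematicalPhysics.StatisticalMechanics.PeriodicConfiguration 3, ∀ R ε : ℝ, 0 < R → 0 < ε → ∃ ρ : ℝ, 0 < ρ ∧ ∃ᶠ N : ℕ in Filter.atTop, ρ * (N : ℝ) ≤ (Nat.card {i : Fin N // ∃ A : EuclideanSpace ℝ (Fin 3) →ₗᵢ[ℝ] EuclideanSpace ℝ (Fin 3), ∃ q ∈ Q.points, (∀ s ∈ Q.points, dist s q ≤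 R → ∃ j : Fin N, dist (x N j) (x N i + A (s - q)) ≤ ε) ∧ (∀ j : Fin N, dist (x N j) (x N i) ≤ R → ∃ s ∈ Q.points, dist (x N j) (x N i + A (s - q)) ≤ ε)} : ℝ)

/-- item stmt-AtomisticToContinuum-16936 · support · rank 9 · open · by planner
sources: Kneser1953, TaoVu2006, Konieczny2023
[support] (card P1/K2(a), the first gap, provable) a periodic configuration whose point set is
δ-separated, (9/10)δ-covered and has #((P+P) ∩ B_R) ≤ θ·#(P ∩ B_R) for some θ < 3/2 and all large R
is a Bravais lattice (one-point motif): finite-abelian Freiman 3/2 in ℝ³/L (Mathlib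
`doubling_lt_three_halves`) puts the motif in a coset of a finite subgroup of index < 3/2·#motif;
density > 2/3 forbids short vectors; covering ≤ (9/10)δ forbids missing points. [difficulty: L] -/
@[route_item "route-AtomisticToContinuum-SumsetDoublingRigidity"]
def FirstGapBravais : Prop :=
  ∀ P : Literature.MathematicalPhysics.StatisticalMechanics.PeriodicConfiguration 3, (∃ δ : ℝ, 0 < δ ∧ (∀ a ∈ P.points, ∀ b ∈ P.points, a ≠ b → δ ≤ dist a b) ∧ (∀ z : EuclideanSpace ℝ (Fin 3), ∃ a ∈ P.points, dist z a ≤ 9 / 10 * δ)) → (∃ θ : ℝ, θ < 3 / 2 ∧ ∃ R₀ : ℝ, ∀ R : ℝ, R₀ ≤ R → ({v : EuclideanSpace ℝ (Fin 3) | ‖v‖ ≤ R ∧ ∃ a ∈ P.points, ∃ b ∈ P.points, v = a + b} : Set (EuclideanSpace ℝ (Fin 3))).Finite ∧ (({v : EuclideanSpace ℝ (Fin 3) | ‖v‖ ≤ R ∧ ∃ a ∈ P.points, ∃ b ∈ P.points, v = a + b} : Set (EuclideanSpace ℝ (Fin 3))).ncard : ℝ) ≤ θ * (({a : EuclideanSpace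 ℝ (Fin 3) | a ∈ P.points ∧ ‖a‖ ≤ R} : Set (EuclideanSpace ℝ (Fin 3))).ncard : ℝ)) → ∃ P' : Literature.MathematicalPhysics.StatisticalMechanics.PeriodicConfiguration 3, P'.motif.card = 1 ∧ P'.points = P.points

/-- item stmt-AtomisticToContinuum-16937 · support · rank 9 · open · by planner
sources: BlancLewin2015, BaakeGrimm2013
[support] (consistency of the rank-2 crux with the expected charged structure; provable) for the hcp
point set hcpStacking a h (a, h > 0) and every θ > 3/2, for all large R the sumset count satisfies
#((X+X) ∩ B_R) ≤ θ·#(X ∩ B_R) (X + X = L ∪ (L+t) ∪ (L+2t) for X = L ∪ (L+t): density ratio exactly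
3/2; lattice-point counting in balls). [difficulty: M] -/
@[route_item "route-AtomisticToContinuum-SumsetDoublingRigidity"]
def HcpDoublingThreeHalves : Prop :=
  ∀ a h : ℝ, 0 < a → 0 < h → ∀ θ : ℝ, 3 / 2 < θ → ∃ R₀ : ℝ, ∀ R : ℝ, R₀ ≤ R → ({v : EuclideanSpace ℝ (Fin 3) | ‖v‖ ≤ R ∧ ∃ p ∈ Literature.MathematicalPhysics.StatisticalMechanics.hcpStacking a h, ∃ q ∈ Literature.MathematicalPhysics.StatisticalMechanics.hcpStacking a h, v = p + q} : Set (EuclideanSpace ℝ (Fin 3))).Finite ∧ (({v : EuclideanSpace ℝ (Fin 3) | ‖v‖ ≤ R ∧ ∃ p ∈ Literature.MathematicalPhysics.StatisticalMechanics.hcpStacking a h, ∃ q ∈ Literature.MathematicalPhysics.StatisticalMechanics.hcpStacking a h, v = p + q} : Set (EuclideanSpace ℝ (Fin 3))).ncard : ℝ) ≤ θ * (({p : EuclideanSpace ℝ (Fin 3) | p ∈ Literature.MathematicalPhysics.StatisticalMechanics.hcpStacking a h ∧ ‖p‖ ≤ R} : Set (EuclideanSpace ℝ (Fin 3))).ncard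 : ℝ)

/-- item stmt-AtomisticToContinuum-2911 · support · rank 9 · open · by planner
why it might fail: Of crystallization strength (wanted by 10 routes): fails iff no periodic structure is charged with positive density — positive density of defects/polytetrahedral order at every N, or only aperiodic (Sturmian-stacked) bulk.
sources: BlancLewin2015, HalesDSP2012
[crux] (finite-N hinge; deterministic shadow of "the Benjamini–Schramm limit of the ground states
charges Q") for every sequence of LJ ground states x^N in ℝ³ there is ONE periodic configuration Q
such that for all R, ε > 0 there is ρ > 0 with, for infinitely many N, at least ρN particles i whose
R-neighbourhood x^N ∩ B_R(x_i) is ε-matched both ways with x_i + A(Q.points − q) for some linear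
isometry A and some base point q ∈ Q.points (base point in Q.points, not a fixed origin: no
vertex-transitivity is forced, cf. refuter note on 0751). Weaker than BulkDefectVanish 0751
(fraction → 1, fixed HCP): positive density, frequently in N, any periodic Q. [deps:
StationaryMinimisersChargePeriodic, NoFoam] [difficulty: XL] -/
@[route_item "route-AtomisticToContinuum-SumsetDoublingRigidity"]
def GroundStatesChargePeriodic : Prop :=
  ∀ x : (N : ℕ) → (Fin N → EuclideanSpace ℝ (Fin 3)), (∀ N, Literature.MathematicalPhysics.StatisticalMechanics.IsGroundState Literature.MathematicalPhysics.StatisticalMechanics.lennardJones (x N)) → ∃ Q : Literature.MathematicalPhysics.StatisticalMechanics.PeriodicConfiguration 3, ∀ R ε : ℝ, 0 < R → 0 < ε → ∃ ρ : ℝ, 0 < ρ ∧ ∃ᶠ N : ℕ in Filter.atTop, ρ * (N : ℝ) ≤ (Nat.card {i : Fin N // ∃ A : EuclideanSpace ℝ (Fin 3) →ₗᵢ[ℝ] EuclideanSpace ℝ (Fin 3), ∃ q ∈ Q.points, (∀ s ∈ Q.points, dist s q ≤ R → ∃ j : Fin N, dist (x N j) (x N i + A (s - q)) ≤ ε) ∧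 (∀ j : Fin N, dist (x N j) (x N i) ≤ R → ∃ s ∈ Q.points, dist (x N j) (x N i + A (s - q)) ≤ ε)} : ℝ)

/-- item stmt-AtomisticToContinuum-16938 · assembly · rank 1 · open · by planner
sources: BlancLewin2015
[assembly] SmallDoublingCharged → DoublingRungRigidity → Crystallization (both conjuncts, via the
proved hinge theorems 2916/2913/0626). -/
@[route_item "route-AtomisticToContinuum-SumsetDoublingRigidity"]
def Assembly : Prop :=
  SmallDoublingCharged → DoublingRungRigidity → _root_.Crystallization

/-! D-0027 §2.1 — DECIDING THEOREM (planner-authored via `route open/edit --closes-file`; by planner-plan-novel-AtomisticToContinuum-Crystal-ad211d65-v2- 2026-08-16T21:43:21Z):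
its hypotheses are this route's items and its conclusion the sub-problem Statement (glue_lint), and it elaborates with this file. -/

@[closes "route-AtomisticToContinuum-SumsetDoublingRigidity"] theorem closes : SmallDoublingCharged → DoublingRungRigidity → _root_.Crystallization := by
  intro hSD hRig
  -- the two cruxes give the hinge (statement of item 2911) for every sequence of ground states
  have hGCP : ∀ x : (N : ℕ) → (Fin N → EuclideanSpace ℝ (Fin 3)),
      (∀ N, Literature.MathematicalPhysics.StatisticalMechanics.IsGroundState
        Literature.MathematicalPhysics.StatisticalMechanics.lennardJones (x N)) →
      ∃ Q : Literature.MathematicalPhysics.StatisticalMechanics.PeriodicConfiguration 3,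
        ∀ R ε : ℝ, 0 < R → 0 < ε → ∃ ρ : ℝ, 0 < ρ ∧ ∃ᶠ N : ℕ in Filter.atTop,
          ρ * (N : ℝ) ≤ (Nat.card {i : Fin N // ∃ A : EuclideanSpace ℝ (Fin 3) →ₗᵢ[ℝ]
            EuclideanSpace ℝ (Fin 3), ∃ q ∈ Q.points,
            (∀ s ∈ Q.points, dist s q ≤ R → ∃ j : Fin N, dist (x N j) (x N i + A (s - q)) ≤ ε) ∧
            (∀ j : Fin N, dist (x N j) (x N i) ≤ R →
              ∃ s ∈ Q.points, dist (x N j) (x N i + A (s - q)) ≤ ε)} : ℝ) := by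
    intro x hx
    obtain ⟨X, hsat, hdoub, hch⟩ := hSD x hx
    obtain ⟨P, hP⟩ := hRig X hsat hdoub
    subst hP
    exact ⟨P, hch⟩
  show Literature.MathematicalPhysics.StatisticalMechanics.HasPeriodicGroundStateEnergy
      Literature.MathematicalPhysics.StatisticalMechanics.lennardJones 3 ∧
    Literature.MathematicalPhysics.StatisticalMechanics.IsCrystallizing
      Literature.MathematicalPhysics.StatisticalMechanics.lennardJones 3
  refine ⟨?_, Summit.AtomisticToContinuum.Crystallization.Theorems.chargedPatternCrystallizes_proof
    hGCP Literature.MathematicalPhysics.StatisticalMechanics.LennardJonesMinimalDistance_holds⟩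
  choose x hx using
    (show ∀ N : ℕ, ∃ y : Fin N → EuclideanSpace ℝ (Fin 3),
        Literature.MathematicalPhysics.StatisticalMechanics.IsGroundState
          Literature.MathematicalPhysics.StatisticalMechanics.lennardJones y from
      Literature.MathematicalPhysics.StatisticalMechanics.LennardJonesGroundStatesExist_holds)
  obtain ⟨Q, hQ⟩ := hGCP x hx
  have hleast :=
    Summit.AtomisticToContinuum.Crystallization.Theorems.chargedPeriodicIsOptimal_proof Q ⟨x, hx, hQ⟩
  refine ⟨Q, hleast, ?_⟩
  have h1 : (⨅ Q' : Literature.MathematicalPhysics.StatisticalMechanics.PeriodicConfiguration 3,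
      Q'.energyPerParticle Literature.MathematicalPhysics.StatisticalMechanics.lennardJones) =
      Q.energyPerParticle Literature.MathematicalPhysics.StatisticalMechanics.lennardJones :=
    hleast.csInf_eq
  rw [← h1]
  exact Summit.AtomisticToContinuum.Crystallization.Theorems.ChargedEnergyGapNegative.crysEnergyLimit

end Summit.AtomisticToContinuum.Crystallization.Theses.SumsetDoublingRigidity
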